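import Mathlib
import HarnessLib
import Summits.AtomisticToContinuum.Crystallization.Theorems.ChartedPlanarOrderDensityDichotomy

/-!
# Density dichotomy beneath `R⋆` — the flat roof feeds the door (kernels K5, K6)

Companion of `Theorems/ChartedPlanarOrderDensityDichotomy.lean` (decomp-a2c, lens 2, g21; same namespace; split off at
landing for the 400-line lint).  Over the `RigidityDoor` vocabulary BY NAME:

  K5 `sparseMisfit_of_flat`    : R⋆♭ → BindingSurface → WindowCounting → SparseMisfit ν  (0 < ν ≤ 1/16)
     — the door consumes ONLY the flat roof `R⋆♭ = DiscreteBarlowRigidityFlat` (R⋆'s `θ`-uniformity and `ε = 0` are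
     unconsumed strength); order of constants: `c₃` (density, WindowCounting at `r = 1`), slack
     `ε' = ε·c·c₃/(2(2/δ+1)³)`, then `C, r` from R⋆♭ at `ε'`, then `C₂` from WindowCounting at `r`, finally
     `R = 2A/ε + 1`, `A = (C₁ + C·C₂)/(c·c₃)`; packing count `nK_atomsIn_le : #atomsIn ≤ (2/δ+1)³R³`;
  K6 `visibleGap_of_flat`, `gap_and_pert_1_50_of_flat`, `gap_and_pert_1_50_of_floor_bulk_dilute` :
     DOOR → SparseNull(≤1/16) → R⋆♭ (resp. Floor♭ ∧ BULK ∧ DILUTE) → BindingSurface → WindowCounting →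
     VisibleGap (1/50) ∧ PertRegime (1/50).

Filed `--supports stmt-AtomisticToContinuum-28120` (helper, DEF-FREE; imports the node module, hence `RigidityDoor` — theses-cone
warning expected as for the node).
-/

noncomputable section

open MeasureTheory Set Metric
open Summit.AtomisticToContinuum.Crystallization.Theorems.ChartedPlanarOrderRigidityDoor

namespace Summit.AtomisticToContinuum.Crystallization.Theorems.ChartedPlanarOrderDensityDichotomy

/-! ## 5. The flat roof feeds the door (K5): `R⋆♭ ∧ BindingSurface ∧ WindowCounting ⟹ SparseMisfit ν` -/

/-- packing: the root's `R`-window of a rooted `δ`-hard-core configuration has `≤ (2/δ+1)³·R³` atoms for `R ≥ 1`. [folklore] -/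
theorem nK_atomsIn_le {δ : ℝ} (hδ : 0 < δ) {μ : Measure E3} (hμ : Literature.Probability.Process.IsRootedHardCore δ μ)
    {R : ℝ} (hR : 1 ≤ R) : nK (atomsIn μ 0 R) ≤ (2 / δ + 1) ^ 3 * R ^ 3 := by
  obtain ⟨S, -, hsep, rfl⟩ := hμ
  have hatom : ∀ p : E3, (Measure.count : Measure E3).restrict S {p} ≠ 0 ↔ p ∈ S := fun p =>
    Literature.Probability.Process.count_restrict_singleton_ne_zero_iff S p
  have hfin : (atomsIn ((Measure.count : Measure E3).restrict S) 0 R).Finite := by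
    have hf : (Metric.closedBall (0 : E3) R ∩ S).Finite :=
      Literature.Probability.Process.LocalConfig.finite_inter_of_separated hδ hsep (isCompact_closedBall (0 : E3) R)
    exact hf.subset fun p hp => ⟨Metric.mem_closedBall.2 hp.2, (hatom p).1 hp.1⟩
  have hR0 : 0 ≤ R := zero_le_one.trans hR
  have hcard := Literature.MathematicalPhysics.StatisticalMechanics.card_le_of_separated_of_dist_le hfin.toFinset (0 : E3) hδ hR0
    (fun c hc => (hfin.mem_toFinset.1 hc).2)
    (fun c hc d hd hcd => hsep c ((hatom c).1 (hfin.mem_toFinset.1 hc).1) d ((hatom d).1 (hfin.mem_toFinset.1 hd).1) hcd)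
  rw [finrank_euclideanSpace_fin] at hcard
  unfold nK
  rw [Set.ncard_eq_toFinset_card _ hfin]
  refine hcard.trans ?_
  have h1 : 2 * R / δ + 1 ≤ (2 / δ + 1) * R := by
    rw [add_mul, div_mul_eq_mul_div, mul_comm 2 R]
    linarith
  calc (2 * R / δ + 1) ^ 3 ≤ ((2 / δ + 1) * R) ^ 3 := pow_le_pow_left₀ (by positivity) h1 3
    _ = (2 / δ + 1) ^ 3 * R ^ 3 := by ring

/-- **K5 — THE FLAT ROOF beneath the translation** (R⋆'s `θ`-uniformity and `ε = 0` are NOT needed by the door):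
`R⋆♭ ∧ BindingSurface ∧ WindowCounting ⟹ SparseMisfit(ν)` for `0 < ν ≤ 1/16`.
Order of constants: `c₃` (density, from WindowCounting at `r = 1`), then the slack `ε' = ε·c·c₃/(2(2/δ+1)³)`, then `C, r` from R⋆♭ at `ε'`,
then `C₂` from WindowCounting at `r`; finally `R = 2A/ε + 1`, `A = (C₁ + C·C₂)/(c·c₃)`. -/
theorem sparseMisfit_of_flat {ν : ℝ} (hν : 0 < ν) (hν' : ν ≤ 1 / 16)
    (hF : DiscreteBarlowRigidityFlat) (hB : BindingSurface) (hW : WindowCounting) : SparseMisfit ν := by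
  intro δ hδ ε hε
  obtain ⟨c, hc, hF'⟩ := hF δ hδ ν hν hν'
  obtain ⟨C₁, hC₁, hB'⟩ := hB δ hδ
  obtain ⟨C₀, hC₀, c₃, hc₃, hW₁⟩ := hW δ hδ 1 one_pos
  set P : ℝ := (2 / δ + 1) ^ 3 with hPdef
  have hP : 0 < P := by positivity
  set ε' : ℝ := ε * c * c₃ / (2 * P) with hε'def
  have hε' : 0 < ε' := by positivity
  obtain ⟨C, hC, r, hr, hF''⟩ := hF' ε' hε'
  obtain ⟨C₂, hC₂, c₃', hc₃', hW₂⟩ := hW δ hδ r hr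
  set A : ℝ := (C₁ + C * C₂) / (c * c₃) with hA
  have hA0 : 0 ≤ A := by positivity
  refine ⟨2 * A / ε + 1, by positivity, ?_⟩
  intro μ hroot hclean hnash hchart hgsc
  set R : ℝ := 2 * A / ε + 1 with hRdef
  have hR1 : 1 ≤ R := by
    have : 0 ≤ 2 * A / ε := by positivity
    linarith
  have hR0 : 0 < R := by linarith
  have hpack : nK (atomsIn μ 0 R) ≤ P * R ^ 3 := nK_atomsIn_le hδ hroot hR1
  obtain ⟨S, h0S, hsep, hμ⟩ := hroot
  -- the chunk K = root's R-window is a clean finite chunk of S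
  have hatom : ∀ p : E3, μ {p} ≠ 0 ↔ p ∈ S := by
    intro p; rw [hμ]; exact Literature.Probability.Process.count_restrict_singleton_ne_zero_iff S p
  have hKS : atomsIn μ 0 R ⊆ S := fun p hp => (hatom p).1 hp.1
  have hKfin : (atomsIn μ 0 R).Finite := by
    have hf : (Metric.closedBall (0 : E3) R ∩ S).Finite :=
      Literature.Probability.Process.LocalConfig.finite_inter_of_separated hδ hsep (isCompact_closedBall (0 : E3) R)
    exact hf.subset fun p hp => ⟨Metric.mem_closedBall.2 hp.2, (hatom p).1 hp.1⟩
  have hKclean : ∀ x ∈ atomsIn μ 0 R, Literature.Geometry.DiscreteGeometry.IsTwoShellGoodSet (1 / 16) (9 / 10) 1 S x := by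
    intro x hx
    have h1 := hclean x hx.1
    have hset : {p : EuclideanSpace ℝ (Fin 3) | μ {p} ≠ 0} = S := by
      ext p; exact hatom p
    rw [hset] at h1
    exact h1
  -- (i) R⋆♭ on K at θ = ν with slack ε'
  have hstar : c * nBad ν S (atomsIn μ 0 R) ≤
      excess S (atomsIn μ 0 R) + C * nBdry r S (atomsIn μ 0 R) + ε' * nK (atomsIn μ 0 R) := by
    have hKS' : atomsIn μ 0 R ⊆ S := hKS
    exact hF'' S (atomsIn μ 0 R) hsep ⟨hKS', hKfin, hKclean⟩
  -- (ii) the μGSC surface bound, (iii) the counting bounds, in the chunk vocabulary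
  have hbind : excess S (atomsIn μ 0 R) ≤ C₁ * R ^ 2 := by
    have h := hB' μ ⟨S, h0S, hsep, hμ⟩ hgsc R hR1
    unfold excess
    rw [hμ] at h ⊢
    exact h
  obtain ⟨hbd, -⟩ := hW₂ μ ⟨S, h0S, hsep, hμ⟩ hclean R hR1
  obtain ⟨-, hdens⟩ := hW₁ μ ⟨S, h0S, hsep, hμ⟩ hclean R hR1
  have hbd' : nBdry r S (atomsIn μ 0 R) ≤ C₂ * R ^ 2 := by
    unfold nBdry
    rw [hμ] at hbd ⊢
    exact hbd
  -- number of unmatched atoms in the window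
  have hbadle : nBad ν S (atomsIn μ 0 R) ≤ ((C₁ + C * C₂) * R ^ 2 + ε' * (P * R ^ 3)) / c := by
    rw [le_div_iff₀ hc]
    have h2 : C * nBdry r S (atomsIn μ 0 R) ≤ C * (C₂ * R ^ 2) := mul_le_mul_of_nonneg_left hbd' hC
    have h3 : ε' * nK (atomsIn μ 0 R) ≤ ε' * (P * R ^ 3) := mul_le_mul_of_nonneg_left hpack hε'.le
    nlinarith [hstar, hbind, h2, h3]
  -- each unmatched atom of the window weighs at most 1/(c₃ R³)
  have hterm : ∀ p ∈ badIn ν μ (atomsIn μ 0 R), (1 : ℝ) / (Set.ncard (atomsIn μ p R) : ℝ) ≤ 1 / (c₃ * R ^ 3) := by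
    intro p hp
    have hp' : p ∈ atomsIn μ 0 R := hp.1
    have hd := hdens p hp'.1 hp'.2
    exact one_div_le_one_div_of_le (by positivity) hd
  have hbadfin : (badIn ν μ (atomsIn μ 0 R)).Finite := hKfin.subset (fun p hp => hp.1)
  have hfrac : windowBadFrac ν R μ ≤ (Set.ncard (badIn ν μ (atomsIn μ 0 R)) : ℝ) * (1 / (c₃ * R ^ 3)) := by
    unfold windowBadFrac
    rw [finsum_mem_eq_finite_toFinset_sum _ hbadfin, Set.ncard_eq_toFinset_card _ hbadfin]
    have hs := Finset.sum_le_card_nsmul hbadfin.toFinset (fun p => (1 : ℝ) / (Set.ncard (atomsIn μ p R) : ℝ)) (1 / (c₃ * R ^ 3))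
      (fun p hp => hterm p (hbadfin.mem_toFinset.1 hp))
    simpa [nsmul_eq_mul] using hs
  have hbadμ : (Set.ncard (badIn ν μ (atomsIn μ 0 R)) : ℝ) = nBad ν S (atomsIn μ 0 R) := by
    unfold nBad
    rw [hμ]
  -- conclusion: windowBadFrac ≤ A/R + ε/2 ≤ ε
  have hR3 : 0 < c₃ * R ^ 3 := by positivity
  have hfin : (Set.ncard (badIn ν μ (atomsIn μ 0 R)) : ℝ) * (1 / (c₃ * R ^ 3)) ≤ ε := by
    rw [hbadμ]
    calc nBad ν S (atomsIn μ 0 R) * (1 / (c₃ * R ^ 3))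
        ≤ ((C₁ + C * C₂) * R ^ 2 + ε' * (P * R ^ 3)) / c * (1 / (c₃ * R ^ 3)) :=
          mul_le_mul_of_nonneg_right hbadle (by positivity)
      _ = A / R + ε / 2 := by
          rw [hA, hε'def]
          field_simp
      _ ≤ ε / 2 + ε / 2 := by
          have h1 : A / R ≤ ε / 2 := by
            rw [div_le_iff₀ hR0]
            have : 2 * A / ε ≤ R := by linarith
            have h' : 2 * A ≤ R * ε := by rwa [div_le_iff₀ hε] at this
            linarith
          linarith
      _ = ε := by ring
  exact hfrac.trans hfin

/-- **K6** the door corollaries with the FLAT roof in place of R⋆ (cf. `RigidityDoor.gap_and_pert_1_50_of_rigidity`). -/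
theorem visibleGap_of_flat {ν : ℝ} (hν : 0 < ν) (hν' : ν ≤ 1 / 16)
    (hD : Summit.AtomisticToContinuum.Crystallization.Theses.GrainCoreNetworkSplit.MuEquilibriumDoor)
    (hN : SparseNull ν) (hF : DiscreteBarlowRigidityFlat) (hB : BindingSurface) (hW : WindowCounting) : VisibleGap ν :=
  visibleGap_of_door_sparse ν hD hN (sparseMisfit_of_flat hν hν' hF hB hW)

/-- **K6** DOOR ∧ SparseNull(≤ 1/16) ∧ R⋆♭ ∧ BindingSurface ∧ WindowCounting ⟹ VisibleGap (1/50) ∧ PertRegime (1/50). -/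
theorem gap_and_pert_1_50_of_flat
    (hD : Summit.AtomisticToContinuum.Crystallization.Theses.GrainCoreNetworkSplit.MuEquilibriumDoor)
    (hN : ∀ η : ℝ, 0 < η → η ≤ 1 / 16 → SparseNull η) (hF : DiscreteBarlowRigidityFlat) (hB : BindingSurface) (hW : WindowCounting) :
    VisibleGap (1 / 50) ∧ PertRegime (1 / 50) :=
  ⟨visibleGap_of_flat (by norm_num) (by norm_num) hD (hN _ (by norm_num) (by norm_num)) hF hB hW,
    pertRegime_of_door_sparse (1 / 50) hD hN (fun _ hη hη' => sparseMisfit_of_flat hη hη' hF hB hW)⟩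

/-- **The node of record beneath the door**: DOOR ∧ SparseNull(≤ 1/16) ∧ BindingSurface ∧ WindowCounting ∧ Floor♭ (proved) ∧ BULK ∧ DILUTE
⟹ VisibleGap (1/50) ∧ PertRegime (1/50). -/
theorem gap_and_pert_1_50_of_floor_bulk_dilute
    (hD : Summit.AtomisticToContinuum.Crystallization.Theses.GrainCoreNetworkSplit.MuEquilibriumDoor)
    (hN : ∀ η : ℝ, 0 < η → η ≤ 1 / 16 → SparseNull η) (hB : BindingSurface) (hW : WindowCounting)
    (hFl : ChunkFloor) (hBu : BulkDefectGap) (hDi : DiluteDefectRate) :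
    VisibleGap (1 / 50) ∧ PertRegime (1 / 50) :=
  gap_and_pert_1_50_of_flat hD hN (flat_of_floor_bulk_dilute hFl hBu hDi) hB hW

/-! ## 5′. THE GENERIC BRANCH ALONE FEEDS THE DOOR (K5′, g21 finding no. 2): `BULK ∧ BindingSurface ∧ WindowCounting ⟹ SparseMisfit ν`

R⋆'s LINEAR RATE in `#bad` (hence DILUTE, hence RATE′ and R⋆♭'s `c`) is NOT consumed by the translation either: a DENSITY DICHOTOMY on the root's
window replaces it.  Fix the threshold `u = min 1 (ε·c₃/(2P))`, `P = (2/δ+1)³`.  SPARSE window (`#bad < u·#K`): `windowBadFrac ≤ #bad/(c₃R³)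
≤ u·P/c₃ ≤ ε/2` for every `R`.  DENSE window (`#bad ≥ u·#K`): BULK at `(ν, u)` gives `η·#K ≤ Σ(e_x − e⋆) + C·#bdry_r ≤ (C₁ + C·C₂)·R²`, so
`#bad ≤ #K ≤ (C₁ + C·C₂)R²/η` and `windowBadFrac ≤ A/R ≤ ε/2` for `R ≥ 2A/ε`, `A = (C₁ + C·C₂)/(η·c₃)`. -/

/-- **K5′** `BulkDefectGap → BindingSurface → WindowCounting → SparseMisfit ν` (`0 < ν ≤ 1/16`): the door's cone below R⋆ contains BULK only. -/
theorem sparseMisfit_of_bulk {ν : ℝ} (hν : 0 < ν) (hν' : ν ≤ 1 / 16)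
    (hBu : BulkDefectGap) (hB : BindingSurface) (hW : WindowCounting) : SparseMisfit ν := by
  intro δ hδ ε hε
  obtain ⟨C₁, hC₁, hB'⟩ := hB δ hδ
  obtain ⟨C₀, hC₀, c₃, hc₃, hW₁⟩ := hW δ hδ 1 one_pos
  set P : ℝ := (2 / δ + 1) ^ 3 with hPdef
  have hP : 0 < P := by positivity
  set u : ℝ := min 1 (ε * c₃ / (2 * P)) with hudef
  have hu : 0 < u := lt_min one_pos (by positivity)
  have hu1 : u ≤ 1 := min_le_left _ _
  have hu2 : u ≤ ε * c₃ / (2 * P) := min_le_right _ _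
  obtain ⟨η, hη, C, hC, r, hr, hBu'⟩ := hBu δ hδ ν hν hν' u hu hu1
  obtain ⟨C₂, hC₂, c₃', hc₃', hW₂⟩ := hW δ hδ r hr
  set A : ℝ := (C₁ + C * C₂) / (η * c₃) with hA
  have hA0 : 0 ≤ A := by positivity
  refine ⟨2 * A / ε + 1, by positivity, ?_⟩
  intro μ hroot hclean hnash hchart hgsc
  set R : ℝ := 2 * A / ε + 1 with hRdef
  have hR1 : 1 ≤ R := by
    have : 0 ≤ 2 * A / ε := by positivity
    linarith
  have hR0 : 0 < R := by linarith
  have hpack : nK (atomsIn μ 0 R) ≤ P * R ^ 3 := nK_atomsIn_le hδ hroot hR1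
  obtain ⟨S, h0S, hsep, hμ⟩ := hroot
  have hatom : ∀ p : E3, μ {p} ≠ 0 ↔ p ∈ S := by
    intro p; rw [hμ]; exact Literature.Probability.Process.count_restrict_singleton_ne_zero_iff S p
  have hKS : atomsIn μ 0 R ⊆ S := fun p hp => (hatom p).1 hp.1
  have hKfin : (atomsIn μ 0 R).Finite := by
    have hf : (Metric.closedBall (0 : E3) R ∩ S).Finite :=
      Literature.Probability.Process.LocalConfig.finite_inter_of_separated hδ hsep (isCompact_closedBall (0 : E3) R)
    exact hf.subset fun p hp => ⟨Metric.mem_closedBall.2 hp.2, (hatom p).1 hp.1⟩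
  have hKclean : ∀ x ∈ atomsIn μ 0 R, Literature.Geometry.DiscreteGeometry.IsTwoShellGoodSet (1 / 16) (9 / 10) 1 S x := by
    intro x hx
    have h1 := hclean x hx.1
    have hset : {p : EuclideanSpace ℝ (Fin 3) | μ {p} ≠ 0} = S := by
      ext p; exact hatom p
    rw [hset] at h1
    exact h1
  -- the μGSC surface bound and the counting bounds, in the chunk vocabulary
  have hbind : excess S (atomsIn μ 0 R) ≤ C₁ * R ^ 2 := by
    have h := hB' μ ⟨S, h0S, hsep, hμ⟩ hgsc R hR1
    unfold excess
    rw [hμ] at h ⊢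
    exact h
  obtain ⟨hbd, -⟩ := hW₂ μ ⟨S, h0S, hsep, hμ⟩ hclean R hR1
  obtain ⟨-, hdens⟩ := hW₁ μ ⟨S, h0S, hsep, hμ⟩ hclean R hR1
  have hbd' : nBdry r S (atomsIn μ 0 R) ≤ C₂ * R ^ 2 := by
    unfold nBdry
    rw [hμ] at hbd ⊢
    exact hbd
  -- each unmatched atom of the window weighs at most 1/(c₃ R³)
  have hterm : ∀ p ∈ badIn ν μ (atomsIn μ 0 R), (1 : ℝ) / (Set.ncard (atomsIn μ p R) : ℝ) ≤ 1 / (c₃ * R ^ 3) := by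
    intro p hp
    have hp' : p ∈ atomsIn μ 0 R := hp.1
    have hd := hdens p hp'.1 hp'.2
    exact one_div_le_one_div_of_le (by positivity) hd
  have hbadfin : (badIn ν μ (atomsIn μ 0 R)).Finite := hKfin.subset (fun p hp => hp.1)
  have hfrac : windowBadFrac ν R μ ≤ (Set.ncard (badIn ν μ (atomsIn μ 0 R)) : ℝ) * (1 / (c₃ * R ^ 3)) := by
    unfold windowBadFrac
    rw [finsum_mem_eq_finite_toFinset_sum _ hbadfin, Set.ncard_eq_toFinset_card _ hbadfin]
    have hs := Finset.sum_le_card_nsmul hbadfin.toFinset (fun p => (1 : ℝ) / (Set.ncard (atomsIn μ p R) : ℝ)) (1 / (c₃ * R ^ 3))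
      (fun p hp => hterm p (hbadfin.mem_toFinset.1 hp))
    simpa [nsmul_eq_mul] using hs
  have hbadμ : (Set.ncard (badIn ν μ (atomsIn μ 0 R)) : ℝ) = nBad ν S (atomsIn μ 0 R) := by
    unfold nBad
    rw [hμ]
  have hR3 : 0 < c₃ * R ^ 3 := by positivity
  have hc₃0 : c₃ ≠ 0 := hc₃.ne'
  have hη0 : η ≠ 0 := hη.ne'
  have hRne : R ≠ 0 := hR0.ne'
  -- THE DENSITY DICHOTOMY on the window
  have hgoal : nBad ν S (atomsIn μ 0 R) * (1 / (c₃ * R ^ 3)) ≤ ε := by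
    rcases lt_or_ge (nBad ν S (atomsIn μ 0 R)) (u * nK (atomsIn μ 0 R)) with hlt | hge
    · -- sparse window: the threshold alone bounds the bad fraction
      have h1 : nBad ν S (atomsIn μ 0 R) ≤ u * (P * R ^ 3) := hlt.le.trans (mul_le_mul_of_nonneg_left hpack hu.le)
      have h2 : u * (2 * P) ≤ ε * c₃ := (le_div_iff₀ (by positivity)).1 hu2
      calc nBad ν S (atomsIn μ 0 R) * (1 / (c₃ * R ^ 3)) ≤ u * (P * R ^ 3) * (1 / (c₃ * R ^ 3)) :=
            mul_le_mul_of_nonneg_right h1 (by positivity)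
        _ = u * P / c₃ := by field_simp
        _ ≤ ε / 2 := by
            rw [div_le_iff₀ hc₃]
            nlinarith [h2]
        _ ≤ ε := by linarith
    · -- dense window: BULK bounds the whole window by its surface
      have hbulk : η * nK (atomsIn μ 0 R) ≤ excess S (atomsIn μ 0 R) + C * nBdry r S (atomsIn μ 0 R) :=
        hBu' S (atomsIn μ 0 R) hsep ⟨hKS, hKfin, hKclean⟩ hge
      have h2 : C * nBdry r S (atomsIn μ 0 R) ≤ C * (C₂ * R ^ 2) := mul_le_mul_of_nonneg_left hbd' hC
      have hnK : nK (atomsIn μ 0 R) ≤ (C₁ + C * C₂) * R ^ 2 / η := by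
        rw [le_div_iff₀ hη]
        nlinarith [hbulk, hbind, h2]
      have h3 : nBad ν S (atomsIn μ 0 R) ≤ (C₁ + C * C₂) * R ^ 2 / η := (nBad_le_nK ν hKfin).trans hnK
      calc nBad ν S (atomsIn μ 0 R) * (1 / (c₃ * R ^ 3)) ≤ (C₁ + C * C₂) * R ^ 2 / η * (1 / (c₃ * R ^ 3)) :=
            mul_le_mul_of_nonneg_right h3 (by positivity)
        _ = A / R := by
            rw [hA]
            field_simp
        _ ≤ ε / 2 := by
            rw [div_le_iff₀ hR0]
            have : 2 * A / ε ≤ R := by linarith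
            have h' : 2 * A ≤ R * ε := by rwa [div_le_iff₀ hε] at this
            linarith
        _ ≤ ε := by linarith
  have hfin : (Set.ncard (badIn ν μ (atomsIn μ 0 R)) : ℝ) * (1 / (c₃ * R ^ 3)) ≤ ε := by
    rw [hbadμ]
    exact hgoal
  exact hfrac.trans hfin

/-- **K6′** the door corollaries from BULK alone (no Floor♭, no DILUTE, no rate). -/
theorem visibleGap_of_bulk {ν : ℝ} (hν : 0 < ν) (hν' : ν ≤ 1 / 16)
    (hD : Summit.AtomisticToContinuum.Crystallization.Theses.GrainCoreNetworkSplit.MuEquilibriumDoor)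
    (hN : SparseNull ν) (hBu : BulkDefectGap) (hB : BindingSurface) (hW : WindowCounting) : VisibleGap ν :=
  visibleGap_of_door_sparse ν hD hN (sparseMisfit_of_bulk hν hν' hBu hB hW)

/-- **THE NODE OF RECORD beneath the door (v3)**: DOOR ∧ SparseNull(≤ 1/16) ∧ BindingSurface ∧ WindowCounting ∧ BULK ⟹ VisibleGap (1/50) ∧ PertRegime (1/50).
The ONLY open residual of this node in the door's cone is `BulkDefectGap`. -/
theorem gap_and_pert_1_50_of_bulk
    (hD : Summit.AtomisticToContinuum.Crystallization.Theses.GrainCoreNetworkSplit.MuEquilibriumDoor)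
    (hN : ∀ η : ℝ, 0 < η → η ≤ 1 / 16 → SparseNull η) (hBu : BulkDefectGap) (hB : BindingSurface) (hW : WindowCounting) :
    VisibleGap (1 / 50) ∧ PertRegime (1 / 50) :=
  ⟨visibleGap_of_bulk (by norm_num) (by norm_num) hD (hN _ (by norm_num) (by norm_num)) hBu hB hW,
    pertRegime_of_door_sparse (1 / 50) hD hN (fun _ hη hη' => sparseMisfit_of_bulk hη hη' hBu hB hW)⟩

/-- and from R⋆ through BULK (sanity: the v3 chain R⋆ → R⋆♭ → RATE′ → BULK → door composes). -/
theorem gap_and_pert_1_50_of_rigidity_via_bulk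
    (hD : Summit.AtomisticToContinuum.Crystallization.Theses.GrainCoreNetworkSplit.MuEquilibriumDoor)
    (hN : ∀ η : ℝ, 0 < η → η ≤ 1 / 16 → SparseNull η) (hR : DiscreteBarlowRigidity) (hB : BindingSurface) (hW : WindowCounting) :
    VisibleGap (1 / 50) ∧ PertRegime (1 / 50) :=
  gap_and_pert_1_50_of_bulk hD hN (bulk_of_rate (rate_of_flat (flat_of_rigidity hR))) hB hW

end Summit.AtomisticToContinuum.Crystallization.Theorems.ChartedPlanarOrderDensityDichotomy

end
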